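import Mathlib
import Summits.ValiantsHypothesis.ValiantsHypothesis.Theorems.LacunarySymmetroidMatrixDescartesDefiniteMomentsRayleigh

/-!
# `MatrixDescartes` (stmt-ValiantsHypothesis-18050) — the DEFINITE-MOMENTS LAW, V: per-vector accounting for
# semidefinite sign words with interior definite moments

HONEST FRAMING.  Cell `pub-symmetroid`, seat `val-sym-mdr-p2` (gen 14); helper file `--supports` the crux
`Theses.LacunarySymmetroid.MatrixDescartes`, NO closure claim; the scalar (one Rayleigh form at a time) half of the
sign-word form of the definite-moments law (`…DefiniteMomentsWord`).  Nothing here bears on the crux in its window, on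
`stub_twoSided`, on `DoorA26`/`DoorA34`, registers, or `VP ≠ VNP`.

SETTING.  `F(x) = ∑ₖ x^{dₖ} Sₖ`, real symmetric `ι × ι` letters, natural exponents; a SEMIDEFINITE SIGN WORD given by a
monotone block index `β : ℕ → ℕ` on exponents with `β ≤ N + 2` and `(−1)^{β(dₖ)} Sₖ ⪰ 0` (block `0` positive
semidefinite, block `1` negative semidefinite, …: at most `V = N + 2` sign changes); INTERIOR MOMENTS
`0 < t₀ < t₁ < ⋯ < t_N` with `(−1)^{j+1} F(tⱼ) ≻ 0` (the `j`-th moment is definite with the sign of block `j + 1`).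

CONTENT (`wordData`).  For every `v ≠ 0` the Rayleigh form `f_v(x) = vᵀF(x)v` satisfies: (1) in each interior gap
`(tᵢ, tᵢ₊₁)` it has at most one zero; (2) on `(0, t₀)`, `0 ≤ f_v(s') ⇒ 0 < f_v(s)` for `s < s'` (downward
propagation); (3) on `(t_N, ∞)` the same for `(−1)^{N+1} f_v`.  PROOF = budget accounting: the Rayleigh `K`-nomial
`P_v = ∑ₖ (vᵀSₖv) X^{dₖ}` has block-signed coefficients, so by `signVariations_add_le_of_signPattern` + Descartes it has
at most `β(deg P_v) − β(trailing degree)` positive zeros («last visible block minus first visible block»); its sign near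
`0⁺` is `(−1)^{β(trailing)}` and near `+∞` is `(−1)^{β(deg)}` (`eventually_pos_near_zero` / `_atTop`); along the
point sequence `u, t₀, …, t_N, M` (with `u` near `0`, `M` near `∞`) the values of `f_v` then show at least that many
sign changes, so the budget is SATURATED: every positive zero of `f_v` is one of the forced gap zeros
(`zeros_in_changing_gaps`), which gives (1)–(3).  [folklore]; axioms `propext`, `Classical.choice`, `Quot.sound`.
-/

-- layout Summits/ValiantsHypothesis/ValiantsHypothesis forces the duplicated namespace component
set_option linter.dupNamespace false

namespace Summit.ValiantsHypothesis.ValiantsHypothesis.Theorems.LacunarySymmetroidMatrixDescartes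

open Polynomial Matrix Finset
open scoped BigOperators

namespace DefiniteMoments

section WordScalar

variable {ι κ : Type} [Fintype ι] [Fintype κ]

/-! ## The per-vector accounting -/

/-- **Per-vector accounting for a sign word with interior definite moments** (see the module docstring): for every
`v ≠ 0`, (1) each interior gap `(tᵢ, tᵢ₊₁)` carries at most one zero of the Rayleigh form `f_v`; (2) on `(0, t₀)`
non-negativity of `f_v` propagates to strict positivity DOWNWARDS; (3) on `(t_N, ∞)` the same holds for
`(−1)^{N+1}·f_v`. [folklore] -/
theorem wordData [DecidableEq ι] (d : κ → ℕ) (S : κ → Matrix ι ι ℝ) (β : ℕ → ℕ) (hβ : Monotone β) (N : ℕ)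
    (hβN : ∀ n, β n ≤ N + 2) (hsign : ∀ k, (((-1 : ℝ) ^ β (d k)) • S k).PosSemidef)
    (t : Fin (N + 1) → ℝ) (ht : StrictMono t) (ht0 : 0 < t 0)
    (hdef : ∀ (j : Fin (N + 1)) (v : ι → ℝ), v ≠ 0 →
      0 < (-1 : ℝ) ^ ((j : ℕ) + 1) * (v ⬝ᵥ ((∑ k, t j ^ d k • S k) *ᵥ v)))
    (v : ι → ℝ) (hv : v ≠ 0) :
    (∀ i : Fin N, ∀ r₁ r₂ : ℝ, t i.castSucc < r₁ → r₁ < t i.succ → t i.castSucc < r₂ → r₂ < t i.succ →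
        v ⬝ᵥ ((∑ k, r₁ ^ d k • S k) *ᵥ v) = 0 → v ⬝ᵥ ((∑ k, r₂ ^ d k • S k) *ᵥ v) = 0 → r₁ = r₂) ∧
    (∀ s s' : ℝ, 0 < s → s < s' → s' < t 0 →
        0 ≤ v ⬝ᵥ ((∑ k, s' ^ d k • S k) *ᵥ v) → 0 < v ⬝ᵥ ((∑ k, s ^ d k • S k) *ᵥ v)) ∧
    (∀ s s' : ℝ, t (Fin.last N) < s → s < s' →
        0 ≤ (-1 : ℝ) ^ (N + 1) * (v ⬝ᵥ ((∑ k, s' ^ d k • S k) *ᵥ v)) →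
        0 < (-1 : ℝ) ^ (N + 1) * (v ⬝ᵥ ((∑ k, s ^ d k • S k) *ᵥ v))) := by
  set f : ℝ → ℝ := fun x => v ⬝ᵥ ((∑ k, x ^ d k • S k) *ᵥ v) with hf
  have hfc : Continuous f := continuous_form d S v
  have hft : ∀ j : Fin (N + 1), 0 < (-1 : ℝ) ^ ((j : ℕ) + 1) * f (t j) := fun j => hdef j v hv
  have hft0 : f (t 0) < 0 := by
    have h := hft 0
    rw [Fin.val_zero, zero_add, pow_one] at h
    linarith
  have hx₀ : v ⬝ᵥ ((∑ k, t 0 ^ d k • S k) *ᵥ v) ≠ 0 := hft0.ne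
  have htpos : ∀ j, 0 < t j := fun j => ht0.trans_le (ht.monotone (Fin.zero_le _))
  -- the Rayleigh K-nomial, its end blocks, its end signs and its budget
  set P := ∑ k, C (v ⬝ᵥ (S k *ᵥ v)) * (X : ℝ[X]) ^ d k with hP
  set b₀ := β P.natTrailingDegree with hb₀
  set b₁ := β P.natDegree with hb₁
  have hb₁N : b₁ ≤ N + 2 := hβN _
  obtain ⟨δ, hδ, hnear⟩ := rayleigh_word_near_zero d S β hsign v hx₀
  obtain ⟨M, hM, hfar⟩ := rayleigh_word_atTop d S β hsign v hx₀
  have hbudget : ∀ T : Finset ℝ, (∀ r ∈ T, 0 < r ∧ f r = 0) → T.card + b₀ ≤ b₁ :=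
    fun T hT => rayleigh_word_budget d S β hβ hsign v hx₀ T hT
  -- the point sequence `u, t₀, …, t_N, M'`
  set u : ℝ := min δ (t 0) / 2 with hu
  have hmin : 0 < min δ (t 0) := lt_min hδ ht0
  have hu0 : 0 < u := by rw [hu]; linarith
  have huδ : u < δ := by rw [hu]; linarith [min_le_left δ (t 0)]
  have hut : u < t 0 := by rw [hu]; linarith [min_le_right δ (t 0)]
  set M' : ℝ := max M (t (Fin.last N)) + 1 with hM'
  have hM'M : M < M' := by rw [hM']; linarith [le_max_left M (t (Fin.last N))]
  have hM't : t (Fin.last N) < M' := by rw [hM']; linarith [le_max_right M (t (Fin.last N))]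
  obtain ⟨q, hq_u, hq_t, hq_M⟩ : ∃ q : Fin (N + 2 + 1) → ℝ, (∀ i : Fin (N + 2 + 1), (i : ℕ) = 0 → q i = u) ∧
      (∀ (i : Fin (N + 2 + 1)) (j : Fin (N + 1)), (i : ℕ) = (j : ℕ) + 1 → q i = t j) ∧
      (∀ i : Fin (N + 2 + 1), (i : ℕ) = N + 2 → q i = M') := by
    refine ⟨fun i : Fin (N + 2 + 1) =>
        if (i : ℕ) = 0 then u else if h : (i : ℕ) ≤ N + 1 then t ⟨(i : ℕ) - 1, by omega⟩ else M',
      fun i hi => by simp only [hi]; rfl, fun i j hij => ?_, fun i hi => ?_⟩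
    · have h1 : ¬ ((i : ℕ) = 0) := by omega
      have h2 : (i : ℕ) ≤ N + 1 := by have := j.isLt; omega
      simp only [h1, h2, if_false, dif_pos]
      congr 1
      ext
      simp only [hij, Nat.add_sub_cancel]
    · have h1 : ¬ ((i : ℕ) = 0) := by omega
      have h2 : ¬ ((i : ℕ) ≤ N + 1) := by omega
      simp only [h1, h2]
      rfl
  have hq0 : q 0 = u := hq_u 0 rfl
  have hq1 : q ⟨1, by omega⟩ = t 0 := hq_t _ 0 rfl
  have hqL : q ⟨N + 1, by omega⟩ = t (Fin.last N) := hq_t _ (Fin.last N) (by simp)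
  have hqL' : q (Fin.last (N + 2)) = M' := hq_M _ (by simp)
  have hqmono : StrictMono q := by
    refine Fin.strictMono_iff_lt_succ.2 fun i => ?_
    have hi := i.isLt
    rcases Nat.eq_zero_or_pos (i : ℕ) with h0 | hpos
    · rw [hq_u i.castSucc (by simp [h0]), hq_t i.succ 0 (by simp [h0])]
      exact hut
    · rcases Nat.lt_or_ge (i : ℕ) (N + 1) with hlt | hge
      · rw [hq_t i.castSucc ⟨(i : ℕ) - 1, by omega⟩ (by simp; omega),
          hq_t i.succ ⟨(i : ℕ), by omega⟩ (by simp)]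
        exact ht (Fin.mk_lt_mk.2 (by omega))
      · have hiN : (i : ℕ) = N + 1 := by omega
        rw [hq_t i.castSucc (Fin.last N) (by simp [hiN]), hq_M i.succ (by simp [hiN])]
        exact hM't
  have hq0pos : 0 < q 0 := by rw [hq0]; exact hu0
  -- which gaps change sign: all interior ones; gap 0 iff `b₀ = 0`-type; the last gap iff the top block is visible
  have hchg_mid : ∀ i : Fin (N + 2), 1 ≤ (i : ℕ) → (i : ℕ) ≤ N → f (q i.castSucc) * f (q i.succ) < 0 := by
    intro i h1 h2
    rw [hq_t i.castSucc ⟨(i : ℕ) - 1, by omega⟩ (by simp; omega), hq_t i.succ ⟨(i : ℕ), by omega⟩ (by simp)]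
    have ha := hft ⟨(i : ℕ) - 1, by omega⟩
    have hb := hft ⟨(i : ℕ), by omega⟩
    have e : (i : ℕ) - 1 + 1 = (i : ℕ) := by omega
    simp only [e] at ha
    exact mul_neg_of_alt _ ha hb
  have hchg_0 : 0 < f u → f (q (0 : Fin (N + 2)).castSucc) * f (q (0 : Fin (N + 2)).succ) < 0 := by
    intro h
    rw [hq_u _ (by simp), hq_t _ 0 (by simp)]
    exact mul_neg_of_pos_of_neg h hft0
  have hchg_L : (-1 : ℝ) ^ (N + 1) * f M' < 0 →
      f (q (Fin.last (N + 1)).castSucc) * f (q (Fin.last (N + 1)).succ) < 0 := by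
    intro h
    rw [hq_t _ (Fin.last N) (by simp), hq_M _ (by simp)]
    have ha := hft (Fin.last N)
    rw [Fin.val_last] at ha
    rcases neg_one_pow_eq_or ℝ (N + 1) with h1 | h1 <;> rw [h1] at ha h <;> nlinarith
  -- the budget of `zeros_in_changing_gaps`
  set CH := (Finset.univ : Finset (Fin (N + 2))).filter (fun i : Fin (N + 2) => f (q i.castSucc) * f (q i.succ) < 0)
    with hCH
  set mid := (Finset.univ : Finset (Fin (N + 2))).filter (fun i : Fin (N + 2) => 1 ≤ (i : ℕ) ∧ (i : ℕ) ≤ N)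
    with hmid
  have hmidN : N ≤ mid.card := by
    have h := Finset.card_le_card_of_injOn (s := (Finset.univ : Finset (Fin N))) (t := mid)
      (fun i : Fin N => (⟨(i : ℕ) + 1, by omega⟩ : Fin (N + 2)))
      (fun i _ => by
        rw [Finset.mem_coe, hmid, Finset.mem_filter]
        exact ⟨Finset.mem_univ _, by simp, Nat.succ_le_of_lt i.isLt⟩)
      (fun i _ i' _ h => by
        have h' : (i : ℕ) + 1 = (i' : ℕ) + 1 := congrArg Fin.val h
        exact Fin.ext (by omega))
    rwa [Finset.card_univ, Fintype.card_fin] at h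
  have hmid_sub : mid ⊆ CH := by
    intro i hi
    rw [hmid, Finset.mem_filter] at hi
    exact Finset.mem_filter.2 ⟨Finset.mem_univ _, hchg_mid i hi.2.1 hi.2.2⟩
  have h0nm : (0 : Fin (N + 2)) ∉ mid := by
    rw [hmid, Finset.mem_filter]; simp
  have hLnm : Fin.last (N + 1) ∉ mid := by
    rw [hmid, Finset.mem_filter]; simp
  have hLn0 : Fin.last (N + 1) ∉ insert (0 : Fin (N + 2)) mid := by
    rw [Finset.mem_insert, not_or]
    exact ⟨fun h => by have := congrArg Fin.val h; simp at this, hLnm⟩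
  have hfu : b₀ = 0 → 0 < f u := by
    intro h
    have h1 := hnear u hu0 huδ
    rw [← hb₀, h, pow_zero, one_mul] at h1
    exact h1
  have hfM' : b₁ = N + 2 → (-1 : ℝ) ^ (N + 1) * f M' < 0 := by
    intro h
    have h1 := hfar M' hM'M
    rw [← hb₁, h, pow_succ] at h1
    have e : (-1 : ℝ) ^ (N + 1) * -1 * f M' = -((-1 : ℝ) ^ (N + 1) * f M') := by ring
    rw [e] at h1
    linarith
  have key : b₁ ≤ CH.card + b₀ := by
    by_cases h0 : b₀ = 0 <;> by_cases hL : b₁ = N + 2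
    · have hsub : insert (Fin.last (N + 1)) (insert (0 : Fin (N + 2)) mid) ⊆ CH := by
        intro i hi
        rw [Finset.mem_insert, Finset.mem_insert] at hi
        rcases hi with rfl | rfl | hi
        · exact Finset.mem_filter.2 ⟨Finset.mem_univ _, hchg_L (hfM' hL)⟩
        · exact Finset.mem_filter.2 ⟨Finset.mem_univ _, hchg_0 (hfu h0)⟩
        · exact hmid_sub hi
      have h := Finset.card_le_card hsub
      rw [Finset.card_insert_of_notMem hLn0, Finset.card_insert_of_notMem h0nm] at h
      omega
    · have hsub : insert (0 : Fin (N + 2)) mid ⊆ CH := by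
        intro i hi
        rw [Finset.mem_insert] at hi
        rcases hi with rfl | hi
        · exact Finset.mem_filter.2 ⟨Finset.mem_univ _, hchg_0 (hfu h0)⟩
        · exact hmid_sub hi
      have h := Finset.card_le_card hsub
      rw [Finset.card_insert_of_notMem h0nm] at h
      omega
    · have hsub : insert (Fin.last (N + 1)) mid ⊆ CH := by
        intro i hi
        rw [Finset.mem_insert] at hi
        rcases hi with rfl | hi
        · exact Finset.mem_filter.2 ⟨Finset.mem_univ _, hchg_L (hfM' hL)⟩
        · exact hmid_sub hi
      have h := Finset.card_le_card hsub
      rw [Finset.card_insert_of_notMem hLnm] at h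
      omega
    · have h := Finset.card_le_card hmid_sub
      omega
  have hbud : ∀ T : Finset ℝ, (∀ r ∈ T, 0 < r ∧ f r = 0) → T.card ≤ CH.card := by
    intro T hT
    have h := hbudget T hT
    omega
  obtain ⟨z, hz, hall⟩ := zeros_in_changing_gaps hfc q hqmono hq0pos hbud
  -- consequences
  have hfirst : ∀ r : ℝ, 0 < r → r < t 0 → f r = 0 → r = z 0 ∧ 0 < f u := by
    intro r hr hrt hfr
    obtain ⟨i, hi, rfl⟩ := hall r hr hfr
    have hi0 : (i : ℕ) = 0 :=
      gap_index_eq_zero q hqmono i (z i) ⟨1, by omega⟩ rfl (hz i hi).1 (by rw [hq1]; exact hrt)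
    have hi0' : i = 0 := Fin.ext hi0
    subst hi0'
    refine ⟨rfl, ?_⟩
    have h := hi
    rw [hq_u _ (by simp), hq_t _ 0 (by simp)] at h
    nlinarith [hft0]
  have hlast : ∀ r : ℝ, t (Fin.last N) < r → f r = 0 →
      r = z (Fin.last (N + 1)) ∧ (-1 : ℝ) ^ (N + 1) * f M' < 0 := by
    intro r hr hfr
    obtain ⟨i, hi, rfl⟩ := hall r ((htpos _).trans hr) hfr
    have hiL : (i : ℕ) + 1 = N + 2 :=
      gap_index_eq_last q hqmono i (z i) ⟨N + 1, by omega⟩ rfl (by rw [hqL]; exact hr) (hz i hi).2.1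
    have hiL' : i = Fin.last (N + 1) := Fin.ext (by rw [Fin.val_last]; omega)
    subst hiL'
    refine ⟨rfl, ?_⟩
    have h := hi
    rw [hq_t _ (Fin.last N) (by simp), hq_M _ (by simp)] at h
    have ha := hft (Fin.last N)
    rw [Fin.val_last] at ha
    rcases neg_one_pow_eq_or ℝ (N + 1) with h1 | h1 <;> rw [h1] at ha ⊢ <;> nlinarith
  have hinterior : ∀ (i : Fin N) (r : ℝ), t i.castSucc < r → r < t i.succ → f r = 0 →
      r = z ⟨(i : ℕ) + 1, by omega⟩ := by
    intro i r hr1 hr2 hfr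
    obtain ⟨i', hi', rfl⟩ := hall r ((htpos _).trans hr1) hfr
    have e : i' = ⟨(i : ℕ) + 1, by omega⟩ :=
      gap_eq_of_mem q hqmono i' ⟨(i : ℕ) + 1, by omega⟩ (z i') (hz i' hi').1 (hz i' hi').2.1
        (by rw [hq_t _ i.castSucc (by simp)]; exact hr1) (by rw [hq_t _ i.succ (by simp)]; exact hr2)
    rw [← e]
  refine ⟨?_, ?_, ?_⟩
  · -- (1) interior gaps carry at most one zero
    intro i r₁ r₂ h1 h1' h2 h2' hf1 hf2
    rw [hinterior i r₁ h1 h1' hf1, hinterior i r₂ h2 h2' hf2]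
  · -- (2) first window, downward propagation
    intro s s' hs hss' hs't hfs'
    show 0 < f s
    by_contra hfs
    push Not at hfs
    rcases neg_one_pow_eq_or ℝ b₀ with hε | hε
    · -- `f > 0` near `0⁺`
      set w : ℝ := min s δ / 2 with hw
      have hminw : 0 < min s δ := lt_min hs hδ
      have hw0 : 0 < w := by rw [hw]; linarith
      have hws : w < s := by rw [hw]; linarith [min_le_left s δ]
      have hwδ : w < δ := by rw [hw]; linarith [min_le_right s δ]
      have hfw : 0 < f w := by have h := hnear w hw0 hwδ; rw [← hb₀, hε, one_mul] at h; exact h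
      obtain ⟨r₁, hr₁, hfr₁⟩ : (0 : ℝ) ∈ f '' Set.Icc w s :=
        intermediate_value_Icc' hws.le hfc.continuousOn ⟨hfs, hfw.le⟩
      obtain ⟨r₂, hr₂, hfr₂⟩ : (0 : ℝ) ∈ f '' Set.Icc s' (t 0) :=
        intermediate_value_Icc' hs't.le hfc.continuousOn ⟨hft0.le, hfs'⟩
      have hr₁0 : 0 < r₁ := hw0.trans_le hr₁.1
      have hr₂t : r₂ < t 0 := lt_of_le_of_ne hr₂.2 (by rintro rfl; exact hft0.ne hfr₂)
      have e₁ := (hfirst r₁ hr₁0 (by linarith [hr₁.2]) hfr₁).1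
      have e₂ := (hfirst r₂ (hs.trans (hss'.trans_le hr₂.1)) hr₂t hfr₂).1
      have : r₁ = r₂ := by rw [e₁, e₂]
      linarith [hr₁.2, hr₂.1]
    · -- `f < 0` near `0⁺`: then `f(s') ≥ 0` is impossible
      set w : ℝ := min s' δ / 2 with hw
      have hminw : 0 < min s' δ := lt_min (hs.trans hss') hδ
      have hw0 : 0 < w := by rw [hw]; linarith
      have hws : w < s' := by rw [hw]; linarith [min_le_left s' δ]
      have hwδ : w < δ := by rw [hw]; linarith [min_le_right s' δ]
      have hfw : f w < 0 := by have h := hnear w hw0 hwδ; rw [← hb₀, hε] at h; linarith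
      obtain ⟨r, hr, hfr⟩ : (0 : ℝ) ∈ f '' Set.Icc w s' :=
        intermediate_value_Icc hws.le hfc.continuousOn ⟨hfw.le, hfs'⟩
      have hfu' := (hfirst r (hw0.trans_le hr.1) (lt_of_le_of_lt hr.2 hs't) hfr).2
      have h := hnear u hu0 huδ
      rw [← hb₀, hε] at h
      linarith
  · -- (3) last window, downward propagation for `(−1)^{N+1} f`
    intro s s' hs hss' hgs'
    show 0 < (-1 : ℝ) ^ (N + 1) * f s
    set g : ℝ → ℝ := fun x => (-1 : ℝ) ^ (N + 1) * f x with hg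
    have hgc : Continuous g := continuous_const.mul hfc
    have hgt : 0 < g (t (Fin.last N)) := by have h := hft (Fin.last N); rwa [Fin.val_last] at h
    have hgzero : ∀ x, g x = 0 → f x = 0 := fun x hx => by
      rcases mul_eq_zero.1 hx with h | h
      · exact absurd h (pow_ne_zero _ (by norm_num))
      · exact h
    show 0 < g s
    by_contra hgs
    push Not at hgs
    obtain ⟨r₁, hr₁, hgr₁⟩ : (0 : ℝ) ∈ g '' Set.Icc (t (Fin.last N)) s :=
      intermediate_value_Icc' hs.le hgc.continuousOn ⟨hgs, hgt.le⟩
    have hr₁t : t (Fin.last N) < r₁ := lt_of_le_of_ne hr₁.1 (by rintro h; rw [← h] at hgr₁; exact hgt.ne' hgr₁)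
    obtain ⟨e₁, hM'neg⟩ := hlast r₁ hr₁t (hgzero r₁ hgr₁)
    rcases lt_or_ge s' M' with hlt | hge
    · obtain ⟨r₂, hr₂, hgr₂⟩ : (0 : ℝ) ∈ g '' Set.Icc s' M' :=
        intermediate_value_Icc' hlt.le hgc.continuousOn ⟨hM'neg.le, hgs'⟩
      have e₂ := (hlast r₂ (hs.trans (hss'.trans_le hr₂.1)) (hgzero r₂ hgr₂)).1
      have : r₁ = r₂ := by rw [e₁, e₂]
      linarith [hr₁.2, hr₂.1]
    · have h1 := hfar M' hM'M
      have h2 := hfar s' (hM'M.trans_le hge)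
      change (-1 : ℝ) ^ (N + 1) * f M' < 0 at hM'neg
      change 0 ≤ (-1 : ℝ) ^ (N + 1) * f s' at hgs'
      rcases neg_one_pow_eq_or ℝ (N + 1) with ha | ha <;> rcases neg_one_pow_eq_or ℝ b₁ with hb | hb <;>
        rw [ha] at hM'neg hgs' <;> rw [← hb₁, hb] at h1 h2 <;> linarith

end WordScalar

end DefiniteMoments

end Summit.ValiantsHypothesis.ValiantsHypothesis.Theorems.LacunarySymmetroidMatrixDescartes
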